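import Summits.Ventures.QEC.Census.CertChunks
import Summits.Ventures.QEC.Census.BB.BB72.Cert
import HarnessLib

/-!
# `BB72` — KERNEL-tier lower-bound replay, side X, leaf file 5/10 (emitted by qec-search-7)

Bruteforce replay (CERT-FORMAT v1 §5.1, lemma L3) of the certificate `7e943c5a566adc43`: every X-type operator of weight
`1 … 5` has nonzero syndrome (rows `cert.HZ`) or is allow-listed (allow-list []). This file holds
9 packed chunk evaluations (`chunk1R`/`chunk2R` of `Census/CertChunks.lean` over `posList 72 cert.HZ`), total
1488207 scan end points, each closed by `decide +kernel` — tier KERNEL (CERTIFIED): axioms ⊆ {propext, Classical.choice,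
Quot.sound}. Assembled in `BB/BB72/KernelX.lean`. Do not edit; re-emit (HOME/census/search-7/emit_kernel.py).
-/

namespace Summit.Ventures.QEC.Census.BB72

/-- Level-2 chunks `(7, j)`, `0 ≤ j < 5`, side X of `BB72` (189715 end points): pass. -/
theorem kX2_7_0 : chunk2R (leafTest []) (posList 72 cert.HZ) 3 7 0 5 = true := by decide +kernel

/-- Level-2 chunks `(7, j)`, `5 ≤ j < 12`, side X of `BB72` (195202 end points): pass. -/
theorem kX2_7_5 : chunk2R (leafTest []) (posList 72 cert.HZ) 3 7 5 7 = true := by decide +kernel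

/-- Level-2 chunks `(7, j)`, `12 ≤ j < 24`, side X of `BB72` (192113 end points): pass. -/
theorem kX2_7_12 : chunk2R (leafTest []) (posList 72 cert.HZ) 3 7 12 12 = true := by decide +kernel

/-- Level-2 chunks `(7, j)`, `24 ≤ j < 64`, side X of `BB72` (102090 end points): pass. -/
theorem kX2_7_24 : chunk2R (leafTest []) (posList 72 cert.HZ) 3 7 24 40 = true := by decide +kernel

/-- Level-2 chunks `(8, j)`, `0 ≤ j < 5`, side X of `BB72` (180555 end points): pass. -/
theorem kX2_8_0 : chunk2R (leafTest []) (posList 72 cert.HZ) 3 8 0 5 = true := by decide +kernel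

/-- Level-2 chunks `(8, j)`, `5 ≤ j < 12`, side X of `BB72` (184786 end points): pass. -/
theorem kX2_8_5 : chunk2R (leafTest []) (posList 72 cert.HZ) 3 8 5 7 = true := by decide +kernel

/-- Level-2 chunks `(8, j)`, `12 ≤ j < 26`, side X of `BB72` (197533 end points): pass. -/
theorem kX2_8_12 : chunk2R (leafTest []) (posList 72 cert.HZ) 3 8 12 14 = true := by decide +kernel

/-- Level-2 chunks `(8, j)`, `26 ≤ j < 63`, side X of `BB72` (74518 end points): pass. -/
theorem kX2_8_26 : chunk2R (leafTest []) (posList 72 cert.HZ) 3 8 26 37 = true := by decide +kernel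

/-- Level-2 chunks `(9, j)`, `0 ≤ j < 5`, side X of `BB72` (171695 end points): pass. -/
theorem kX2_9_0 : chunk2R (leafTest []) (posList 72 cert.HZ) 3 9 0 5 = true := by decide +kernel

end Summit.Ventures.QEC.Census.BB72
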